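import Summits.BirchSwinnertonDyer.BirchSwinnertonDyer.Theses.ResidualThetaTransportAtTwo
import Summits.BirchSwinnertonDyer.BirchSwinnertonDyer.Theorems.ResidualThetaTransportAtTwoAwayDefs
import Summits.BirchSwinnertonDyer.BirchSwinnertonDyer.Theorems.ResidualThetaTransportAtTwoResidualSignedLambdaLowerCMAtTwoReciprocityExhaustion
import Summits.BirchSwinnertonDyer.BirchSwinnertonDyer.Theorems.ResidualThetaTransportAtTwoResidualSignedLambdaLowerCMAtTwoReciprocityAdmissible
import Summits.BirchSwinnertonDyer.BirchSwinnertonDyer.Theorems.ResidualThetaTransportAtTwoResidualSignedLambdaLowerCMAtTwoReciprocityKummer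
import Summits.BirchSwinnertonDyer.BirchSwinnertonDyer.Theorems.ResidualThetaTransportAtTwoResidualSignedLambdaLowerCMAtTwoReciprocityLevelSum
import Summits.BirchSwinnertonDyer.BirchSwinnertonDyer.Theorems.ResidualThetaTransportAtTwoResidualSignedLambdaLowerCMAtTwoDeepHalfAwayTwoLocKerTransfer
import Summits.BirchSwinnertonDyer.BirchSwinnertonDyer.Theorems.ResidualThetaTransportAtTwoResidualSignedLambdaLowerCMAtTwoDeepHalfAwayTwoOrthogonal
import Summits.BirchSwinnertonDyer.BirchSwinnertonDyer.Theorems.ResidualThetaTransportAtTwoResidualSignedLambdaLowerCMAtTwoRhoLayerPairingConj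
import Summits.BirchSwinnertonDyer.BirchSwinnertonDyer.Theorems.ResidualThetaTransportAtTwoResidualSignedLambdaLowerCMAtTwoStubDeepHalfAtTwoStrictPins
import Summits.BirchSwinnertonDyer.BirchSwinnertonDyer.Theorems.ResidualThetaTransportAtTwoResidualSignedLambdaLowerCMAtTwoCofreeAdmissible
import Literature.NumberTheory.EllipticCurves.Kato2004.IwasawaCohomologyCoeffNewform
import HarnessLib

/-!
# EH `stub_reciprocity` of line `onepair` (crux RSL_g `ResidualSignedLambdaLowerCMAtTwo`, stmt-BirchSwinnertonDyer-22608) — the registered v3b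
# text BY NAME: the one-pair local characters of `x ∈ 𝐇¹_Γ(T_ρ)` sum to zero on every relaxed Selmer class

Route `ResidualThetaTransportAtTwo` (RTT), crux RSL_g, line «onepair» (skeleton v3b, `Cruxes/ResidualSignedLambdaLowerCMAtTwo/Lines/onepair.lean`,
sha16 43d71e773b988889), split stub **EH `stub_reciprocity`** (lane of seat `prover-bsd-wall-tp2-p2x-w3` g17; `--supports`, closes nothing by
itself). THEOREMS ONLY (no definition, no named fact, no instance, no `sorry`). BSD is not proved by any of this; RSL_g (22608) and K3 (20308) stay OPEN.

PROOF (all inputs by name). Given `x ∈ I.H` and `s ∈ selRelSubgroup`: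
1. `s = τ_{n₀,K} [β]` for a cocycle `β` of `Γ_{n₀}` with values in `A_ρ[2^K]` (`Reciprocity.exists_transfer_eq`, p704367);
2. a Θ-Kummer datum `Q` of `β|_{Γ_∞}` at `v = π.v` with `2^K Q ∈ E(ℚ_{∞,v})^n` (`Reciprocity.exists_towerKummer_of_level_cocycle`), and a deep
   layer `L ≥ n₀, n_w (w ∈ S₀)` with `loc_v b = thetaLayerKummer L (2^K Q)` for `b := res_{Γ_L} [β]`
   (`Reciprocity.exists_forall_layerLocOf_eq_thetaLayerKummer`);
3. the 2-side term: `π₂.c₂ (π.locd₂ x) (loc₂ s) = (⟨loc_v red_K x_L, loc_v b⟩_{L,2^K,v}).val • 2^{-K}` (`AtTwoPins.hc₂` on the pulled-back datum,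
   `OnePairPins.hlocd₂`, `hpair`, `rhoLayerPairingPk_apply`);
4. the S₀-side terms: `πₐ.locdS x w c (locAway s w c) = (⟨loc_w(c.out · red_K x_L), loc_w(c.out · b)⟩_{L,2^K,w}).val • 2^{-K}`
   (`locAway_transferH1`, `AwayPins.hlocdS`, `reduceH1CofreePkTorsion_conjMap`);
5. the levelwise sum vanishes (`Reciprocity.levelwise_reciprocity_cosets` = p688154 + Mackey), with `red_K x_L` admissible by Kato's
   integrality `IwasawaH1DataCoeff.proj_mem` and `b` admissible by `Reciprocity.admissible_of_transfer_mem_unramifiedOutside` (p704597);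
6. `t ↦ t.val • 2^{-K}` is additive `ℤ/2^K → ℚ/ℤ` (`AwayOrthogonal.val_smul_add`).
The binder `hζ2` is not used (EH reads every value at ONE level `2^K`).

References: [MilneADT2006] Ch. I Thm. 4.10 (b); [NeukirchSchmidtWingberg2008] VIII §1; [Kobayashi2003] Thm. 7.3, (8.23); [Kato2004Asterisque] §17.13;
[PerrinRiou1994Invent] §3.6.1; [CoatesGreenberg1996] Cor. 3.2.
-/

set_option autoImplicit false
-- the Theorems namespace of this sub repeats the summit name by design (D-0017 nested layout)
set_option linter.dupNamespace false

noncomputable section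

open scoped Classical NumberField

namespace Summit.BirchSwinnertonDyer.BirchSwinnertonDyer.Theorems.OnePair

open CategoryTheory Field NumberField IsDedekindDomain WeierstrassCurve
  Literature.NumberTheory.EllipticCurves Literature.NumberTheory.GaloisRepresentations
  Literature.NumberTheory.EllipticCurves.GreenbergSelmer Literature.NumberTheory.EllipticCurves.GreenbergVatsal2000
  Literature.NumberTheory.EllipticCurves.CyclotomicLayer Literature.NumberTheory.EllipticCurves.Kobayashi2003
  Literature.NumberTheory.EllipticCurves.Kato2004 Rat.HeightOneSpectrum
  Summit.BirchSwinnertonDyer.BirchSwinnertonDyer.Theorems.ThetaTransport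

set_option maxHeartbeats 1600000 in
/-- **EH `stub_reciprocity`** (the registered v3b text VERBATIM): for every datum of RSL_g, every pin bundle `π` (with `hζ2`), `π₂ : AtTwoPins π`,
`πₐ : AwayPins π`, every `x ∈ 𝐇¹_Γ(T_ρ)` and every relaxed Selmer class `s`, the 2-side character value `π₂.c₂ (π.locd₂ x) (loc₂ s)` plus the
S₀-side values `Σ_{w,c} πₐ.locdS x w c (locAway s w c)` is `0` — Tate–Poitou reciprocity `Σ_v inv_v = 0` at a common deep level, read through the pins.
[cite: MilneADT2006, Ch. I, Thm. 4.10 (b)] [cite: NeukirchSchmidtWingberg2008, VIII §1] [cite: Kobayashi2003, Thm. 7.3] -/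
theorem stub_reciprocity :
    open Literature.NumberTheory.EllipticCurves GreenbergSelmer GreenbergVatsal2000 Kobayashi2003 ModularForms Rank1Residual Literature.NumberTheory.GaloisRepresentations Literature.NumberTheory.Automorphic IsDedekindDomain NumberField Field Rat.HeightOneSpectrum PowerSeries Summit.BirchSwinnertonDyer.BirchSwinnertonDyer.Theorems.OnePair in ∀ (W : WeierstrassCurve ℚ) [W.IsElliptic] [W.IsGloballyMinimal], GoodSS W 2 → W.frobeniusTrace 2 = 0 → W.Δ < 0 → ∀ (M : ℕ) [NeZero M] (g : CuspForm (CongruenceSubgroup.Gamma0 M) 2) (ι : coeffField g →+* PadicAlgCl 2), Odd M → IsNewform0 g → IsCMForm (liftToGamma1 M 2 g) → cuspCoeff g 2 = 0 → (∀ ℓ : ℕ, ℓ.Prime → ¬ ℓ ∣ 2 * M * W.conductorNorm ℤ → ‖embCoeff g ι ℓ - (W.frobeniusTrace ℓ : PadicAlgCl 2)‖ < 1) → ∀ (κ : ZpExtension ℚ 2) (γ : absoluteGaloisGroup ℚ), κ.IsCyclotomic → κ.IsTopGenerator γ → IsCyclotomicVariable 2 γ → ∀ (S₀ : Finset (HeightOneSpectrum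 (RingOfIntegers ℚ))), (∀ v ∈ S₀, ((2 : ℕ) : RingOfIntegers ℚ) ∉ v.asIdeal) → (∀ v, ¬ W.HasGoodReductionAt v → v ∈ S₀) → (∀ v, natGenerator v ∣ M → v ∈ S₀) → ∀ (n : ℕ) (ρ : FramedGaloisRep ℚ (coeffO (Set.range ι)) 2) (Θ : ∀ v : HeightOneSpectrum (RingOfIntegers ℚ), ((2 : ℕ) : RingOfIntegers ℚ) ∈ v.asIdeal → (CofreeF (Set.range ι) ρ ≃+ (Fin n → ↥(W.geomPrimaryTorsion 2)))), (∀ v, ¬ natGenerator v ∣ 2 * M → ρ.IsUnramifiedAt v ∧ ∃ P : Polynomial (coeffO (Set.range ι)), P.map (padicCoeffIntegers (Set.range ι)).subtype = Polynomial.X ^ 2 - Polynomial.C (embCoeff g ι (natGenerator v)) * Polynomial.X + Polynomial.C ((natGenerator v : ℕ) : PadicAlgCl 2) ∧ ρ.HasFrobCharpolyAt v P) → ∀ (hΘ : ∀ v hv (δ : absoluteGaloisGroup (v.adicCompletion ℚ)) m i, Θ v hv (resGalOfEmb (closureEmb (K := ℚ) (v.adicCompletion ℚ)) δ • m) i = resGalOfEmb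 (closureEmb (K := ℚ) (v.adicCompletion ℚ)) δ • Θ v hv m i), ∀ (ϖ : (coeffO (Set.range ι))), Irreducible ϖ → ∀ (Sg : AddSubgroup (H1Γ (Set.range ι) κ ρ)) [Module (coeffO (Set.range ι)) ↥Sg], (∀ (a : (coeffO (Set.range ι))) (s : ↥Sg), ((a • s : ↥Sg) : H1Γ (Set.range ι) κ ρ) = scalarH1 κ.kerSubgroup (CofreeF (Set.range ι) ρ) a s) → (∀ y : H1Γ (Set.range ι) κ ρ, y ∈ Sg ↔ y ∈ plusSelmerSet (Set.range ι) W κ S₀ n ρ Θ) → (∀ (τ : absoluteGaloisGroup ℚ) (y : H1Γ (Set.range ι) κ ρ), y ∈ Sg → conjH1 κ.kerSubgroup (CofreeF (Set.range ι) ρ) τ y ∈ Sg) → (plusSelmerTorsionSet (Set.range ι) W κ S₀ n ρ Θ ϖ).Finite → ∀ (I : Kato2004.IwasawaH1DataCoeff (FramedGaloisRep.toGaloisRep ρ) 2 κ γ) [Module (coeffO (Set.range ι)) I.H] [IsScalarTower (coeffO (Set.range ι)) (IwasawaAlgebraO (Set.range ι)) I.H], (∀ (a : (coeffO (Set.range ι)))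 (x : I.H), a • x = (PowerSeries.C a : IwasawaAlgebraO (Set.range ι)) • x) → ∀ (π : OnePairPins (Set.range ι) W κ γ S₀ n ρ Θ hΘ I Sg) (hζ2 : ∀ k : ℕ, π.ζ (k + 1) ^ 2 = π.ζ k), ∀ [Module ℤ_[2] (Dloc (Set.range ι) κ ρ π.v)] (π₂ : AtTwoPins (Set.range ι) κ ρ S₀ W γ n Θ hΘ I Sg π) [∀ w : ↥S₀, Module ℤ_[2] (Dloc (Set.range ι) κ ρ (w : HeightOneSpectrum (RingOfIntegers ℚ)))] (πₐ : AwayPins (Set.range ι) κ ρ S₀ W γ n Θ hΘ I Sg π), ∀ (x : I.H) (s : H1Γ (Set.range ι) κ ρ), s ∈ selRelSubgroup (Set.range ι) κ ρ S₀ → π₂.c₂ (π.locd₂ x) (locKer (Set.range ι) κ ρ π.v s) + ∑ w : ↥S₀, ∑ᶠ c : Cosets κ (w : HeightOneSpectrum (RingOfIntegers ℚ)), πₐ.locdS x w c (locAway (Set.range ι) κ ρ S₀ s w c) = 0 := by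
  intro W _ _ hss ha2 hΔ M _ g ι hodd hnew hcm hcusp hcong κ γ hκ hγ hcyc S₀ hS₀2 hbad hMS₀ n ρ Θ hρ hΘ ϖ hϖ Sg _ hsmul hSg hconj hfin
    I _ _ hIsmul π hζ2 _ π₂ _ πₐ x s hs
  haveI : CompactSpace (absoluteGaloisGroup ℚ) := absoluteGaloisGroup_compactSpace ℚ
  -- (1) `s` as a transfer `τ_{n₀,K} [β]`
  -- (`have` then `obtain`: `rcases` on a composite term would generalize it over the large goal)
  have hex := Reciprocity.exists_transfer_eq (Set.range ι) ρ κ s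
  obtain ⟨k₁, hk₁⟩ := hex
  have hex₀ := hk₁ k₁ le_rfl 0
  obtain ⟨n₀, -, b₀, hb₀⟩ := hex₀
  have hb₀' := oneCocycleClass_surjective
    (subgroupRep (cofreeTorsionGaloisModule (Set.range ι) ρ ((2 ^ k₁ : ℕ) : ℤ)).toTopRep (κ.layerSubgroup n₀)) b₀
  obtain ⟨β, rfl⟩ := hb₀'
  haveI : NeZero (2 ^ k₁) := ⟨pow_ne_zero k₁ two_ne_zero⟩
  -- (2) the Θ-Kummer datum of `β|_{Γ_∞}` at `v = π.v`, with exponent `K = k₁`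
  have hKum := Reciprocity.exists_towerKummer_of_level_cocycle W (Set.range ι) ρ (Θ π.v π.hv) κ π.v (hΘ π.v π.hv)
    hss hκ π.hv k₁ n₀ β
  obtain ⟨Q, hQ, hid⟩ := hKum
  have hlay := ThetaTransport.exists_common_layer W π.v (fun i ↦ (⟨(2 ^ k₁) • Q i, hQ i⟩ :
    ↥(Sprung2012.localTowerPointsOfEmb κ (closureEmb (K := ℚ) (π.v.adicCompletion ℚ)) W)))
  obtain ⟨n₁, hn₁⟩ := hlay
  have hdeep := Reciprocity.exists_forall_layerLocOf_eq_thetaLayerKummer (Set.range ι) ρ k₁ W (Θ π.v π.hv) κ π.v (hΘ π.v π.hv)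
    n₀ n₁ β Q (fun i ↦ (2 ^ k₁) • Q i) (fun _ ↦ rfl) hn₁ hid
  obtain ⟨m, hm, hkum⟩ := hdeep
  -- the working layer `L ≥ m ≥ n₀, n₁` and `L ≥ nfl w` for `w ∈ S₀`
  obtain ⟨L, hmL, hLS₀⟩ : ∃ L : ℕ, m ≤ L ∧ ∀ w ∈ S₀, nfl w ≤ L :=
    ⟨max m (S₀.sup nfl), le_max_left _ _, fun w hw ↦ (Finset.le_sup (f := nfl) hw).trans (le_max_right _ _)⟩
  have hn₀L : n₀ ≤ L := (le_max_left n₀ n₁).trans (hm.trans hmL)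
  have hn₁L : n₁ ≤ L := (le_max_right n₀ n₁).trans (hm.trans hmL)
  -- the level class at layer `L` and its transfer
  have hbs : resOfLe (Cofree ρ ↥(padicCoeffField (Set.range ι))) (κ.kerSubgroup_le_layerSubgroup L)
      (pushH1 (κ.layerSubgroup L) (AddSubgroup.torsionBy (Cofree ρ ↥(padicCoeffField (Set.range ι))) ((2 ^ k₁ : ℕ) : ℤ)).subtype
        (CofreeSelmerTransfer.torsionBy_subtype_smul (Set.range ι) ρ ((2 ^ k₁ : ℕ) : ℤ))
        (resLe (cofreeTorsionGaloisModule (Set.range ι) ρ ((2 ^ k₁ : ℕ) : ℤ)).toTopRep (κ.layerSubgroup_antitone hn₀L) 1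
          (oneCocycleClass _ β))) = s := by
    rw [← hb₀, ThetaTransport.resOfLe_pushH1, ThetaTransport.resOfLe_pushH1]
    congr 1
    exact congrArg (fun f ↦ f (oneCocycleClass _ β))
      (resOfLe_comp_holds (M := ↥(AddSubgroup.torsionBy (Cofree ρ ↥(padicCoeffField (Set.range ι))) ((2 ^ k₁ : ℕ) : ℤ)))
        (κ.kerSubgroup_le_layerSubgroup L) (κ.layerSubgroup_antitone hn₀L))
  -- (3) the 2-side term, read at layer `L`
  have hPL : ∀ i, (2 ^ k₁) • Q i ∈ localLayerPointsOfEmb κ (closureEmb (K := ℚ) (π.v.adicCompletion ℚ)) W L :=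
    fun i ↦ localLayerPointsOfEmb_mono κ (closureEmb (K := ℚ) (π.v.adicCompletion ℚ)) W ((le_max_right n₀ n₁).trans (hm.trans hmL)) (hn₁ i)
  -- `loc₂ s` IS `j_{L,K}` of the Θ-Kummer class of `P = 2^K Q` at layer `L`
  have hloc : locKer (Set.range ι) κ ρ π.v s =
      jAway (Set.range ι) κ ρ π.v L k₁ (thetaLayerKummer (Set.range ι) ρ k₁ W (Θ π.v π.hv) κ π.v (hΘ π.v π.hv) L
        (fun i ↦ ⟨(2 ^ k₁) • Q i, hPL i⟩)) :=
    ((congrArg (locKer (Set.range ι) κ ρ π.v) hbs.symm).trans (AwayLocKerTransfer.locKer_transferH1 (Set.range ι) κ ρ π.v L k₁ _)).trans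
      (congrArg (jAway (Set.range ι) κ ρ π.v L k₁) (hkum L hmL))
  -- its local Kummer datum (chosen roots `R` of `P`)
  have hKD := AtTwoPackage.exists_localKummerData_jAway_thetaLayerKummer (Set.range ι) ρ W (Θ π.v π.hv) κ π.v (hΘ π.v π.hv) L k₁
    (fun i ↦ ⟨(2 ^ k₁) • Q i, hPL i⟩)
  obtain ⟨ψ, R, hψ, hR, hidR⟩ := hKD
  have hRt : ∀ i, (2 ^ k₁) • R i ∈ Sprung2012.localTowerPointsOfEmb κ (closureEmb (K := ℚ) (π.v.adicCompletion ℚ)) W := fun i ↦ by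
    rw [hR i]; exact hQ i
  have h2 : π₂.c₂ (π.locd₂ x) (locKer (Set.range ι) κ ρ π.v s) =
      (layerPairingH1Of (cofreeTorsionGaloisModule (Set.range ι) ρ ((2 ^ k₁ : ℕ) : ℤ)) (2 ^ k₁) (π.ePk k₁) (π.hμPk k₁) (π.hadd₁Pk k₁)
        (π.hadd₂Pk k₁) (π.hgalPk k₁) κ π.v L
        (layerLocOf (cofreeTorsionGaloisModule (Set.range ι) ρ ((2 ^ k₁ : ℕ) : ℤ)) κ π.v L
          (reduceH1CofreePkTorsion (Set.range ι) ρ k₁ (κ.layerSubgroup L) (I.proj L x)))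
        (layerLocOf (cofreeTorsionGaloisModule (Set.range ι) ρ ((2 ^ k₁ : ℕ) : ℤ)) κ π.v L
          (resLe (cofreeTorsionGaloisModule (Set.range ι) ρ ((2 ^ k₁ : ℕ) : ℤ)).toTopRep (κ.layerSubgroup_antitone hn₀L) 1
            (oneCocycleClass _ β)))).val • ((((2 : ℚ) ^ k₁)⁻¹ : ℚ) : AddCircle (1 : ℚ)) := by
    have htup : (fun i ↦ (⟨(2 ^ k₁) • R i, hRt i⟩ : ↥(Sprung2012.localTowerPointsOfEmb κ (closureEmb (K := ℚ) (π.v.adicCompletion ℚ)) W))) =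
        fun i ↦ ⟨(2 ^ k₁) • Q i, Sprung2012.localLayerPointsOfEmb_le_localTowerPointsOfEmb κ
          (closureEmb (K := ℚ) (π.v.adicCompletion ℚ)) W L (hPL i)⟩ :=
      funext fun i ↦ Subtype.ext (hR i)
    calc π₂.c₂ (π.locd₂ x) (locKer (Set.range ι) κ ρ π.v s)
        = π₂.c₂ (π.locd₂ x) (jAway (Set.range ι) κ ρ π.v L k₁ (thetaLayerKummer (Set.range ι) ρ k₁ W (Θ π.v π.hv) κ π.v (hΘ π.v π.hv) L
            (fun i ↦ ⟨(2 ^ k₁) • Q i, hPL i⟩))) := congrArg (π₂.c₂ (π.locd₂ x)) hloc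
      _ = (PadicInt.toZModPow k₁ (π.locd₂ x (fun i ↦ ⟨(2 ^ k₁) • R i, hRt i⟩))).val • ((((2 : ℚ) ^ k₁)⁻¹ : ℚ) : AddCircle (1 : ℚ)) :=
          π₂.hc₂ (π.locd₂ x) _ ψ R k₁ hRt hψ hidR
      _ = (PadicInt.toZModPow k₁ (π.pair L (I.proj L x) (fun i ↦ ⟨(2 ^ k₁) • Q i, hPL i⟩))).val •
            ((((2 : ℚ) ^ k₁)⁻¹ : ℚ) : AddCircle (1 : ℚ)) :=
          congrArg (fun t : ℤ_[2] ↦ (PadicInt.toZModPow k₁ t).val • ((((2 : ℚ) ^ k₁)⁻¹ : ℚ) : AddCircle (1 : ℚ)))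
            ((congrArg (π.locd₂ x) htup).trans (π.hlocd₂ L x (fun i ↦ (2 ^ k₁) • Q i) hPL))
      _ = _ :=
          congrArg (fun t : ZMod (2 ^ k₁) ↦ t.val • ((((2 : ℚ) ^ k₁)⁻¹ : ℚ) : AddCircle (1 : ℚ)))
            ((π.hpair L k₁ (I.proj L x) (fun i ↦ ⟨(2 ^ k₁) • Q i, hPL i⟩)).trans
              ((rhoLayerPairingPk_apply (Set.range ι) ρ W π.ePk π.hμPk π.hadd₁Pk π.hadd₂Pk π.hgalPk (Θ π.v π.hv) κ π.v (hΘ π.v π.hv)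
                  L k₁ (I.proj L x) (fun i ↦ ⟨(2 ^ k₁) • Q i, hPL i⟩)).trans
                (congrArg (layerPairingH1Of (cofreeTorsionGaloisModule (Set.range ι) ρ ((2 ^ k₁ : ℕ) : ℤ)) (2 ^ k₁) (π.ePk k₁) (π.hμPk k₁)
                  (π.hadd₁Pk k₁) (π.hadd₂Pk k₁) (π.hgalPk k₁) κ π.v L
                  (layerLocOf (cofreeTorsionGaloisModule (Set.range ι) ρ ((2 ^ k₁ : ℕ) : ℤ)) κ π.v L
                    (reduceH1CofreePkTorsion (Set.range ι) ρ k₁ (κ.layerSubgroup L) (I.proj L x)))) (hkum L hmL).symm)))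
  -- (4) the S₀-side terms, read at layer `L`
  have h4 : ∀ (w : ↥S₀) (c : Cosets κ (w : HeightOneSpectrum (𝓞 ℚ))),
      πₐ.locdS x w c (locAway (Set.range ι) κ ρ S₀ s w c) =
        (layerPairingH1Of (cofreeTorsionGaloisModule (Set.range ι) ρ ((2 ^ k₁ : ℕ) : ℤ)) (2 ^ k₁) (π.ePk k₁) (π.hμPk k₁) (π.hadd₁Pk k₁)
          (π.hadd₂Pk k₁) (π.hgalPk k₁) κ w L
          (layerLocOf (cofreeTorsionGaloisModule (Set.range ι) ρ ((2 ^ k₁ : ℕ) : ℤ)) κ w L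
            (conjMap (cofreeTorsionGaloisModule (Set.range ι) ρ ((2 ^ k₁ : ℕ) : ℤ)).toTopRep (κ.layerSubgroup L) c.out 1
              (reduceH1CofreePkTorsion (Set.range ι) ρ k₁ (κ.layerSubgroup L) (I.proj L x))))
          (layerLocOf (cofreeTorsionGaloisModule (Set.range ι) ρ ((2 ^ k₁ : ℕ) : ℤ)) κ w L
            (conjMap (cofreeTorsionGaloisModule (Set.range ι) ρ ((2 ^ k₁ : ℕ) : ℤ)).toTopRep (κ.layerSubgroup L) c.out 1
              (resLe (cofreeTorsionGaloisModule (Set.range ι) ρ ((2 ^ k₁ : ℕ) : ℤ)).toTopRep (κ.layerSubgroup_antitone hn₀L) 1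
                (oneCocycleClass _ β))))).val • ((((2 : ℚ) ^ k₁)⁻¹ : ℚ) : AddCircle (1 : ℚ)) := by
    intro w c
    calc πₐ.locdS x w c (locAway (Set.range ι) κ ρ S₀ s w c)
        = πₐ.locdS x w c (jAway (Set.range ι) κ ρ w L k₁
            (layerLocOf (cofreeTorsionGaloisModule (Set.range ι) ρ ((2 ^ k₁ : ℕ) : ℤ)) κ w L
              (conjMap (cofreeTorsionGaloisModule (Set.range ι) ρ ((2 ^ k₁ : ℕ) : ℤ)).toTopRep (κ.layerSubgroup L) c.out 1
                (resLe (cofreeTorsionGaloisModule (Set.range ι) ρ ((2 ^ k₁ : ℕ) : ℤ)).toTopRep (κ.layerSubgroup_antitone hn₀L) 1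
                  (oneCocycleClass _ β))))) :=
          (congrArg (fun s' ↦ πₐ.locdS x w c (locAway (Set.range ι) κ ρ S₀ s' w c)) hbs.symm).trans
            (congrArg (πₐ.locdS x w c) (AwayLocKerTransfer.locAway_transferH1 (Set.range ι) κ ρ S₀ w c L k₁ _))
      _ = _ := πₐ.hlocdS w c L (hLS₀ w w.2) k₁ x _
      _ = _ :=
          congrArg (fun a ↦ (layerPairingOf (cofreeTorsionGaloisModule (Set.range ι) ρ ((2 ^ k₁ : ℕ) : ℤ)) (2 ^ k₁) (π.ePk k₁) (π.hμPk k₁)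
              (π.hadd₁Pk k₁) (π.hadd₂Pk k₁) (π.hgalPk k₁) κ w L a
              (layerLocOf (cofreeTorsionGaloisModule (Set.range ι) ρ ((2 ^ k₁ : ℕ) : ℤ)) κ w L
                (conjMap (cofreeTorsionGaloisModule (Set.range ι) ρ ((2 ^ k₁ : ℕ) : ℤ)).toTopRep (κ.layerSubgroup L) c.out 1
                  (resLe (cofreeTorsionGaloisModule (Set.range ι) ρ ((2 ^ k₁ : ℕ) : ℤ)).toTopRep (κ.layerSubgroup_antitone hn₀L) 1
                    (oneCocycleClass _ β))))).val • ((((2 : ℚ) ^ k₁)⁻¹ : ℚ) : AddCircle (1 : ℚ)))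
            (reduceH1CofreePkTorsion_conjMap (Set.range ι) ρ k₁ (κ.layerSubgroup L) c.out (I.proj L x))
  -- (5) the levelwise sum vanishes
  haveI : FiniteDimensional ℚ (ModularForms.coeffField g) := ModularForms.IsNewform0.finiteDimensional_coeffField_holds hnew
  haveI : CompactSpace (coeffO (Set.range ι)) := OnePairPins.compactSpace_coeffO_of_finiteDimensional ι
  have hρ' : ∀ w : HeightOneSpectrum (𝓞 ℚ), w ∉ (↑S₀ : Set (HeightOneSpectrum (𝓞 ℚ))) → ((2 : ℕ) : 𝓞 ℚ) ∉ w.asIdeal →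
      FramedGaloisRep.IsUnramifiedAt w ρ :=
    fun w hw h2 ↦ OnePairPins.isUnramifiedAt_of_habitat (ρ := ρ) (fun v hv ↦ (hρ v hv).1) hMS₀ w (fun h ↦ hw (Finset.mem_coe.2 h)) h2
  have hb_adm := Reciprocity.admissible_of_transfer_mem_unramifiedOutside (Set.range ι) ρ κ ((2 ^ k₁ : ℕ) : ℤ) L hρ'
    (S' := (↑(insert π.v S₀) : Set (HeightOneSpectrum (𝓞 ℚ)))) (by rw [Finset.coe_insert]; exact Set.subset_insert _ _)
    (fun v' hv' ↦ by rw [Finset.coe_insert]; exact Or.inl (AtTwoPackage.eq_of_two_mem_asIdeal π.hv hv'))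
    (b := resLe (cofreeTorsionGaloisModule (Set.range ι) ρ ((2 ^ k₁ : ℕ) : ℤ)).toTopRep (κ.layerSubgroup_antitone hn₀L) 1
      (oneCocycleClass _ β))
    (by rw [hbs]; exact ((mem_selRelSubgroup_iff (Set.range ι) κ ρ S₀ s).1 hs).1)
  have hsum := Reciprocity.levelwise_reciprocity_cosets W hss hΔ g ι hnew hcong ρ hρ ϖ hϖ κ hκ π.v π.hv S₀ hS₀2 k₁ L hLS₀
    (π.ePk k₁) (π.hμPk k₁) (π.hadd₁Pk k₁) (π.hadd₂Pk k₁) (π.hgalPk k₁)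
    (reduceH1CofreePkTorsion (Set.range ι) ρ k₁ (κ.layerSubgroup L) (I.proj L x))
    (resLe (cofreeTorsionGaloisModule (Set.range ι) ρ ((2 ^ k₁ : ℕ) : ℤ)).toTopRep (κ.layerSubgroup_antitone hn₀L) 1 (oneCocycleClass _ β))
    (fun v' hv' 𝔓 h𝔓 ↦ by
      have hK := (Kato2004.mem_integralH1_iff _ _ _ _).1 (I.proj_mem L x) v'
        (Reciprocity.primesEquiv_ne_two_of_not_mem π.hv S₀ hv') 𝔓 h𝔓
      exact (ThetaTransport.reduceH1CofreePkTorsion_resLe (Set.range ι) ρ k₁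
        (inf_le_left : κ.layerSubgroup L ⊓ 𝔓.inertia (absoluteGaloisGroup ℚ) ≤ κ.layerSubgroup L) (I.proj L x)).symm.trans
        ((congrArg (fun c ↦ reduceH1CofreePkTorsion (Set.range ι) ρ k₁ (κ.layerSubgroup L ⊓ 𝔓.inertia (absoluteGaloisGroup ℚ)) c)
          hK).trans (map_zero _)))
    (fun v' hv' 𝔓 h𝔓 ↦ hb_adm v' (fun h ↦ hv' (Finset.mem_coe.1 h)) 𝔓 h𝔓)
  -- (6) assemble in `ℚ/ℤ` (term-level on the large goal: no `rw` through the pins)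
  refine (congrArg₂ (· + ·) h2 (Fintype.sum_congr _ _ fun w ↦ finsum_congr fun c ↦ h4 w c)).trans ?_
  haveI hF : ∀ m : ℕ, Fintype (absoluteGaloisGroup ℚ ⧸ κ.layerSubgroup m) := fun m ↦ κ.fintypeQuotientLayer m
  simp only [finsum_eq_sum_of_fintype] at hsum ⊢
  -- the additive map `t ↦ t.val • 2^{-K}`
  let χ : ZMod (2 ^ k₁) →+ AddCircle (1 : ℚ) :=
    { toFun := fun t ↦ t.val • ((((2 : ℚ) ^ k₁)⁻¹ : ℚ) : AddCircle (1 : ℚ))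
      map_zero' := by simp
      map_add' := fun a b ↦ by
        have h := AwayOrthogonal.val_smul_add (N := 2 ^ k₁) a b
        rw [Nat.cast_pow, Nat.cast_ofNat] at h
        exact h }
  have hχ : ∀ t : ZMod (2 ^ k₁), t.val • ((((2 : ℚ) ^ k₁)⁻¹ : ℚ) : AddCircle (1 : ℚ)) = χ t := fun _ ↦ rfl
  simp only [hχ, ← map_sum, ← map_add, hsum, map_zero]

end Summit.BirchSwinnertonDyer.BirchSwinnertonDyer.Theorems.OnePair

end
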